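import Literature.InformationTheory.QuantumCodes.OptimalRadius
import Summits.Ventures.QEC.Census.HB.HB40.Distance
import Summits.Ventures.QEC.Census.HB.HB120w6.Distance
import Summits.Ventures.QEC.Census.HB.HB90b.Distance
import Summits.Ventures.QEC.Census.LP.LP36w5.Distance
import HarnessLib

/-!
# Q4 theorem column — optimal correction radius of the certificate-kernel CSS rows HB40, HB120w6, HB90b, LP36w5 (4 rows)

LADDER-QEC (venture cell `qec`), PARTITION row 08 (decoders / correction radius), rung Q4. The four census rows below are
CERTIFIED in the kernel as exact `[[n, k, d]]` codes (`CSSCode.IsCode` on the certificate's CSS code `cert.code _` over the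
qubits `Fin n`, check rows = the LITERAL gens lists; `…/Distance.lean` of each code's Census directory: `isCode`):
Kovalev–Pryadko 2013 hyperbicycle codes `HB40` `[[40, 2, 6]]` (Ex. 7), `HB120w6` `[[120, 32, 4]]`, `HB90b` `[[90, 8, 8]]` (Ex. 8),
and the lifted-product code `LP36w5` `[[36, 4, 6]]` (census cell D.1-lite). This file adds each row's radius-column entry:

  `(cert.code _).HasOptimalRadius t`, `t = ⌊(d − 1)/2⌋` (Literature/InformationTheory/QuantumCodes/OptimalRadius.lean) — SOME
  Pauli decoder (sector-wise minimum-weight decoding, a specified function of the syndrome) corrects every Pauli error of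
  symplectic weight `≤ t` and not every one of weight `≤ t + 1`, and NO Pauli decoder — no function of the syndrome whatsoever,
  sector-wise or not — corrects every Pauli error of weight `≤ t + 1` (Gottesman 1997 §2.3; Nielsen–Chuang §10.5.5 p. 467;
  Delfosse–Nickerson 2021 §3 "both of these bounds are tight").

Each proof = `CSSCode.IsCode.hasOptimalRadius_of_eq <Code>.isCode rfl`. The statements quantify over the commutation proof `h`
fed to `DistCert.code` (proof-irrelevant: `cert.code h` is one object for all `h`), so no certificate replay is re-run here.
TIER: CERTIFIED, KERNEL-std — pure corollaries, no `decide`, axioms ⊆ {propext, Classical.choice, Quot.sound}. HONEST FRAMING: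
CERTIFIED column, method = theorem (optimal radius by the generic min-weight decoder + optimality over ALL decoders); explicit
decoder tables / BP+OSD radius certificates for these codes are qec-search-6's COMPUTED / A∧ref rows — a different lane; nothing
probabilistic; the printed parameters are the cited papers' CLAIMS, certified upstream, not here. qec-type-08 gen 3.
-/

namespace Summit.Ventures.QEC.Census

open Literature.InformationTheory.QuantumCodes

/-- Radius column of census row `HB_h0-1_n2_c5_chi3` = `HB40` (Kovalev–Pryadko hyperbicycle `[[40, 2, 6]]`, KERNEL-std by
`HB40.isCode`): OPTIMAL correction radius `2 = ⌊(6−1)/2⌋` — attained by sector-wise minimum-weight decoding, and no Pauli decoder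
corrects every Pauli error of weight `≤ 3`. (proved)
[cite: Gottesman1997, §2.3 (chunk p0014 L3)] [cite: KovalevPryadko2013, §IV.G Ex. 7 (arXiv:1212.6703 tex chunk p0016 L18-24)] -/
theorem HB40.hasOptimalRadius (h : commOK HB40.cert.n HB40.cert.HX HB40.cert.HZ = true) :
    (HB40.cert.code h).HasOptimalRadius 2 :=
  HB40.isCode.hasOptimalRadius_of_eq rfl

/-- Radius column of census row `HB_h0-2-8_n2_c15_chi2` = `HB120w6` (Kovalev–Pryadko hyperbicycle `[[120, 32, 4]]`, KERNEL-std by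
`HB120w6.isCode`): OPTIMAL correction radius `1 = ⌊(4−1)/2⌋` — attained by sector-wise minimum-weight decoding, and no Pauli
decoder corrects every Pauli error of weight `≤ 2`. (proved) [cite: Gottesman1997, §2.3 (chunk p0014 L3)] -/
theorem HB120w6.hasOptimalRadius (h : commOK HB120w6.cert.n HB120w6.cert.HX HB120w6.cert.HZ = true) :
    (HB120w6.cert.code h).HasOptimalRadius 1 :=
  HB120w6.isCode.hasOptimalRadius_of_eq rfl

/-- Radius column of census row `HB_h0-3-4_n3_c5_chi3` = `HB90b` (Kovalev–Pryadko hyperbicycle `[[90, 8, 8]]`, KERNEL-std by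
`HB90b.isCode`): OPTIMAL correction radius `3 = ⌊(8−1)/2⌋` — attained by sector-wise minimum-weight decoding, and no Pauli
decoder corrects every Pauli error of weight `≤ 4`. (proved)
[cite: Gottesman1997, §2.3 (chunk p0014 L3)] [cite: KovalevPryadko2013, §IV.G Ex. 8 (arXiv:1212.6703 tex chunk p0016 L26-29)] -/
theorem HB90b.hasOptimalRadius (h : commOK HB90b.cert.n HB90b.cert.HX HB90b.cert.HZ = true) :
    (HB90b.cert.code h).HasOptimalRadius 3 :=
  HB90b.isCode.hasOptimalRadius_of_eq rfl

/-- Radius column of census row `LPb_3x3_l6_b0-1_E0-0-0.0-2-4.0-4-2` = `LP36w5` (lifted-product `[[36, 4, 6]]`, cell D.1-lite,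
KERNEL-std by `LP36w5.isCode`): OPTIMAL correction radius `2 = ⌊(6−1)/2⌋` — attained by sector-wise minimum-weight decoding,
and no Pauli decoder corrects every Pauli error of weight `≤ 3`. (proved) [cite: Gottesman1997, §2.3 (chunk p0014 L3)] -/
theorem LP36w5.hasOptimalRadius (h : commOK LP36w5.cert.n LP36w5.cert.HX LP36w5.cert.HZ = true) :
    (LP36w5.cert.code h).HasOptimalRadius 2 :=
  LP36w5.isCode.hasOptimalRadius_of_eq rfl

end Summit.Ventures.QEC.Census
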